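import Summits.SmoothPoincare4.SmoothPoincare4.Theorems.ConvexBisectionAcyclicBisectionExistsSeamExtendedPage
import Literature.Topology.FourManifolds.OrientedConnectedSumExistence
import Literature.Topology.FourManifolds.OpenEmbeddingBoundaryRestrict
import HarnessLib

/-!
# Seam transport, ST4 (4b, the seam map): the seam read on the boundary 3-manifold of the base
(wave 5, brick X3-3a of sub-node ST4 `node_ST4_twistSign` of node T3c-2 `node_seam_transport` of
stub `stub_T3_dualPresentation` (T3), line `modp-braid-orbits`, crux
`ConvexBisection.AcyclicBisectionExists`, item stmt-SmoothPoincare4-10508; registered sub-goal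
`helper_seamLift_forced`)

Data of a fibred model: `X = Base g ∪_{h̄} (handles)` (data `D`: the open embedding `D.jA` of the
base minus the cores), a boundary datum `bX` of `X`, the seam `Ψ : bX.carrier ≅ ∂ Base g`
(`(bBase g).carrier`, the canonical boundary 3-manifold of the base).  Node T3c-2 reads framed page
knots of `∂ Base g` off the cores in `∂X` through lifts `z`, `u` (`bX.incl (z θ) = D.jA (K θ)`,
`d(bX.incl)(u θ) = d(jA)(ν θ)`).  This file organises these lifts as ONE map on the boundary
3-manifold `Y = ∂ Base g`:

* §1 `jAY y` (`= D.jA y` off the cores), `seamLift y = bX.incl⁻¹ (jAY y) ∈ bX.carrier`,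
  `seamY = Ψ ∘ seamLift : Y → Y` and `seamB = incl ∘ seamY : Y → Base g` — THE SEAM MAP; all are
  `C^∞` on the open set `seamDom h = Y ∖ cores` (`jA` is smooth on the open submanifold, the inverse of
  a boundary inclusion is smooth on the boundary, `BoundaryData.contMDiffOn_inclInv`);
* §2 differentials: `d(jAY)_y = d(jA) ∘ (u ↦ (0, u))` (`hasMFDerivAt_jAY`, through the corestriction
  to the open submanifold, `hasMFDerivAt_codRestrict_opens`), hence
  `d(bX.incl) (d(seamLift) e) = d(jA) (0, e)` (`mfderiv_incl_seamLift`) and `d(seamLift)` is injective;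
* §3 **the lifts are forced** (`helper_seamLift_forced`): if `bX.incl z = D.jA y` then
  `z = seamLift y`, and if moreover `d(bX.incl)_z u = d(jA)_y ν` with `ν` tangent to the boundary
  (`ν₀ = 0`) then `u = d(seamLift)_y (tail ν)`; consequently the pushed point and the pushed framing
  vector of node T3c-2 are `seamB y` and `d(seamB)_y (tail ν)`.

Everything is proved; no named facts, no `sorry`.  References: A. Kosinski, *Differential Manifolds*
(1993), VI §6 [Kosinski1993]; J. M. Lee, *Introduction to Smooth Manifolds* (2013), Thm. 5.11,
Cor. 5.30 [LeeSmoothManifolds2013].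
-/

noncomputable section

set_option linter.dupNamespace false

open scoped Manifold ContDiff Topology

namespace Summit.SmoothPoincare4.SmoothPoincare4.Theorems.AcyclicBisectionExists.ModpBraidOrbits

open Set Function Filter Metric Topology
open Literature.Topology.FourManifolds Literature.Topology.FourManifolds.HandleAttachingMap
  Literature.Topology.FourManifolds.BoundaryManifold Literature.Topology.FourManifolds.LefschetzBase
  Literature.Geometry.Symplectic

section Seam

variable {g : ℕ} {ι : Type} [Finite ι] {h : ι → HandleAttachingMap 3 2 (Base g)}
  {X : Type} [TopologicalSpace X] [ChartedSpace (EuclideanHalfSpace 4) X] [IsManifold (𝓡∂ 4) ∞ X]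
  (D : MultiAttachmentData h (𝓡∂ 4) X) (bX : BoundaryData (𝓡∂ 4) X (𝓡 3)) [Nonempty bX.carrier]
  (Ψ : bX.carrier ≃ₘ⟮𝓡 3, 𝓡 3⟯ (bBase g).carrier)

/-! ## §1 The seam map on the boundary 3-manifold -/

/-- The domain of the seam map: the points of `∂ Base g` off the cores. [folklore] -/
def seamDom (h : ι → HandleAttachingMap 3 2 (Base g)) : Set (bBase g).carrier :=
  {y | (y.1 : Base g) ∈ coresComplement h}

/-- Membership in the domain of the seam map. [folklore] -/
theorem mem_seamDom {y : (bBase g).carrier} : y ∈ seamDom h ↔ (y.1 : Base g) ∈ coresComplement h :=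
  Iff.rfl

/-- The domain of the seam map is open. [folklore] -/
theorem isOpen_seamDom : IsOpen (seamDom h) :=
  (coresComplement h).isOpen.preimage continuous_subtype_val

open Classical in
/-- **`jA` read on the boundary 3-manifold**: `D.jA y` for `y` off the cores (junk elsewhere).
[cite: Kosinski1993, VI §6] -/
def jAY (y : (bBase g).carrier) : X :=
  if hy : (y.1 : Base g) ∈ coresComplement h then D.jA ⟨y.1, hy⟩ else bX.incl (Ψ.symm y)

omit [IsManifold (𝓡∂ 4) ∞ X] [Nonempty bX.carrier] in
/-- `jAY` off the cores. [folklore] -/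
theorem jAY_of_mem {y : (bBase g).carrier} (hy : (y.1 : Base g) ∈ coresComplement h) :
    jAY D bX Ψ y = D.jA ⟨y.1, hy⟩ := dif_pos hy

omit [Nonempty bX.carrier] in
/-- `jAY` takes boundary values. [cite: Kosinski1993, VI §6] -/
theorem jAY_mem_boundary {y : (bBase g).carrier} (hy : (y.1 : Base g) ∈ coresComplement h) :
    jAY D bX Ψ y ∈ (𝓡∂ 4).boundary X := by
  rw [jAY_of_mem D bX Ψ hy]
  exact (isBoundaryPoint_jA_iff D ⟨y.1, hy⟩).2 y.2

/-- **The lift to `bX.carrier`**: `seamLift y = bX.incl⁻¹ (jA y)`. [cite: LeeSmoothManifolds2013, Thm. 5.11] -/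
def seamLift (y : (bBase g).carrier) : bX.carrier := bX.inclInv (jAY D bX Ψ y)

/-- `bX.incl (seamLift y) = D.jA y`. [folklore] -/
theorem incl_seamLift {y : (bBase g).carrier} (hy : (y.1 : Base g) ∈ coresComplement h) :
    bX.incl (seamLift D bX Ψ y) = D.jA ⟨y.1, hy⟩ := by
  rw [seamLift, bX.incl_inclInv (jAY_mem_boundary D bX Ψ hy), jAY_of_mem D bX Ψ hy]

/-- **The seam map on the boundary 3-manifold**: `seamY = Ψ ∘ seamLift`. [cite: Kosinski1993, VI §6] -/
def seamY (y : (bBase g).carrier) : (bBase g).carrier := Ψ (seamLift D bX Ψ y)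

/-- **The seam map with values in the base**: `seamB y = incl (Ψ (seamLift y)) ∈ ∂ Base g`. [cite: Kosinski1993, VI §6] -/
def seamB (y : (bBase g).carrier) : Base g := (seamY D bX Ψ y).1

omit [IsManifold (𝓡∂ 4) ∞ X] in
/-- Unfolding `seamB`. [folklore] -/
theorem seamB_eq (y : (bBase g).carrier) :
    seamB D bX Ψ y = (bBase g).incl (Ψ (seamLift D bX Ψ y)) := rfl

omit [IsManifold (𝓡∂ 4) ∞ X] in
/-- `seamB` takes boundary values: `rho (seamB y) = 1/4`. [folklore] -/
theorem rho_seamB (y : (bBase g).carrier) : rho g (seamB D bX Ψ y).1 = 1 / 4 :=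
  (RegularSublevel.mem_boundary_iff (isRegularLevel_rho g) _).1 (seamY D bX Ψ y).2

/-- The page clause read through the seam map: `w (seamB y) = r · w y`, `r > 0`, off the cores.
[folklore] -/
theorem w_seamB
    (hpage : ∀ (y : bX.carrier) (a : ↥(coresComplement h)), bX.incl y = D.jA a →
      ∃ c : ℝ, 0 < c ∧ w g ((bBase g).incl (Ψ y)).1 = (c : ℂ) * w g (a : Base g).1)
    {y : (bBase g).carrier} (hy : (y.1 : Base g) ∈ coresComplement h) :
    ∃ r : ℝ, 0 < r ∧ w g (seamB D bX Ψ y).1 = (r : ℂ) * w g y.1.1 :=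
  hpage (seamLift D bX Ψ y) ⟨y.1, hy⟩ (incl_seamLift D bX Ψ hy)

omit [IsManifold (𝓡∂ 4) ∞ X] [Nonempty bX.carrier] in
/-- **`jAY` is smooth off the cores** (restriction of `jA` to the open submanifold). [cite: Kosinski1993, VI §6] -/
theorem contMDiffOn_jAY : ContMDiffOn (𝓡 3) (𝓡∂ 4) ∞ (jAY D bX Ψ) (seamDom h) := by
  intro y hy
  let UO : TopologicalSpace.Opens (bBase g).carrier := ⟨seamDom h, isOpen_seamDom⟩
  have hinc : ContMDiff (𝓡 3) (𝓡∂ 4) ∞ (fun x : UO => (⟨x.1.1, x.2⟩ : ↥(coresComplement h))) := by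
    rw [← ContMDiff.subtypeVal_comp_iff]
    exact (bBase g).isSmoothEmbedding.contMDiff.comp contMDiff_subtype_val
  have hres : ContMDiff (𝓡 3) (𝓡∂ 4) ∞ (fun x : UO => jAY D bX Ψ x) := by
    have e : (fun x : UO => jAY D bX Ψ x) = fun x : UO => D.jA ⟨x.1.1, x.2⟩ :=
      funext fun x => jAY_of_mem D bX Ψ x.2
    rw [e]
    exact D.hjA.contMDiff.comp hinc
  exact (contMDiffAt_subtype_iff.mp (hres ⟨y, hy⟩)).contMDiffWithinAt

/-- **`seamLift` is smooth off the cores** (`BoundaryData.contMDiffOn_inclInv`). [cite: LeeSmoothManifolds2013, Thm. 5.11] -/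
theorem contMDiffOn_seamLift : ContMDiffOn (𝓡 3) (𝓡 3) ∞ (seamLift D bX Ψ) (seamDom h) :=
  bX.contMDiffOn_inclInv.comp (contMDiffOn_jAY D bX Ψ) fun _ hy => by
    rw [bX.range_incl]; exact jAY_mem_boundary D bX Ψ hy

/-- `seamLift` is smooth at points off the cores. [folklore] -/
theorem contMDiffAt_seamLift {y : (bBase g).carrier} (hy : (y.1 : Base g) ∈ coresComplement h) :
    ContMDiffAt (𝓡 3) (𝓡 3) ∞ (seamLift D bX Ψ) y :=
  (contMDiffOn_seamLift D bX Ψ).contMDiffAt (isOpen_seamDom.mem_nhds hy)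

/-- **The seam map `seamY` is smooth off the cores.** [cite: Kosinski1993, VI §6] -/
theorem contMDiffOn_seamY : ContMDiffOn (𝓡 3) (𝓡 3) ∞ (seamY D bX Ψ) (seamDom h) :=
  Ψ.contMDiff.comp_contMDiffOn (contMDiffOn_seamLift D bX Ψ)

/-- **The seam map `seamB` is smooth off the cores.** [cite: Kosinski1993, VI §6] -/
theorem contMDiffOn_seamB : ContMDiffOn (𝓡 3) (𝓡∂ 4) ∞ (seamB D bX Ψ) (seamDom h) :=
  (bBase g).isSmoothEmbedding.contMDiff.comp_contMDiffOn (contMDiffOn_seamY D bX Ψ)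

/-- `seamB` is smooth at points off the cores. [folklore] -/
theorem contMDiffAt_seamB {y : (bBase g).carrier} (hy : (y.1 : Base g) ∈ coresComplement h) :
    ContMDiffAt (𝓡 3) (𝓡∂ 4) ∞ (seamB D bX Ψ) y :=
  (contMDiffOn_seamB D bX Ψ).contMDiffAt (isOpen_seamDom.mem_nhds hy)

/-! ## §2 Differentials -/

omit [IsManifold (𝓡∂ 4) ∞ X] [Nonempty bX.carrier] in
/-- **The differential of `jAY`**: `d(jAY)_y = d(jA)_y ∘ (u ↦ (0, u))`. [cite: LeeSmoothManifolds2013, Cor. 5.30] -/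
theorem hasMFDerivAt_jAY {y : (bBase g).carrier} (hy : (y.1 : Base g) ∈ coresComplement h) :
    HasMFDerivAt (𝓡 3) (𝓡∂ 4) (jAY D bX Ψ) y
      ((mfderiv (𝓡∂ 4) (𝓡∂ 4) D.jA ⟨y.1, hy⟩).comp (consZeroL 3)) := by
  classical
  let a : ↥(coresComplement h) := ⟨y.1, hy⟩
  let codr : (bBase g).carrier → ↥(coresComplement h) := fun y' =>
    if hy' : (y'.1 : Base g) ∈ coresComplement h then ⟨y'.1, hy'⟩ else a
  have hfe : (fun y' => ((codr y' : ↥(coresComplement h)) : Base g)) =ᶠ[𝓝 y] (bBase g).incl := by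
    filter_upwards [isOpen_seamDom.mem_nhds hy] with y' hy'
    have hy'' : (y'.1 : Base g) ∈ coresComplement h := hy'
    show ((codr y' : ↥(coresComplement h)) : Base g) = y'.1
    simp only [codr, dif_pos hy'']
  have hf : HasMFDerivAt (𝓡 3) (𝓡∂ 4) (fun y' => ((codr y' : ↥(coresComplement h)) : Base g)) y
      (consZeroL 3) :=
    (hasMFDerivAt_incl_boundaryData (n := 3) y).congr_of_eventuallyEq hfe
  have hcodr : HasMFDerivAt (𝓡 3) (𝓡∂ 4) codr y (consZeroL 3) :=
    hasMFDerivAt_codRestrict_opens (fun _ => rfl) hf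
  have hjA : HasMFDerivAt (𝓡∂ 4) (𝓡∂ 4) D.jA (codr y) (mfderiv (𝓡∂ 4) (𝓡∂ 4) D.jA (codr y)) :=
    (mdifferentiableAt_jA D _).hasMFDerivAt
  have hcomp := hjA.comp y hcodr
  have hya : codr y = a := dif_pos hy
  rw [hya] at hcomp
  have he : jAY D bX Ψ =ᶠ[𝓝 y] D.jA ∘ codr := by
    filter_upwards [isOpen_seamDom.mem_nhds hy] with y' hy'
    have hy'' : (y'.1 : Base g) ∈ coresComplement h := hy'
    rw [jAY_of_mem D bX Ψ hy'']
    show D.jA ⟨y'.1, hy''⟩ = D.jA (codr y')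
    simp only [codr, dif_pos hy'']
  exact hcomp.congr_of_eventuallyEq he

/-- **The differential of the lift**: `d(bX.incl) (d(seamLift)_y e) = d(jA)_y (0, e)`. [cite: LeeSmoothManifolds2013, Cor. 5.30] -/
theorem mfderiv_incl_seamLift {y : (bBase g).carrier} (hy : (y.1 : Base g) ∈ coresComplement h)
    (e : EuclideanSpace ℝ (Fin 3)) :
    mfderiv (𝓡 3) (𝓡∂ 4) bX.incl (seamLift D bX Ψ y)
        (mfderiv (𝓡 3) (𝓡 3) (seamLift D bX Ψ) y e) =
      mfderiv (𝓡∂ 4) (𝓡∂ 4) D.jA ⟨y.1, hy⟩ (consZeroL 3 e) := by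
  have hsl : MDifferentiableAt (𝓡 3) (𝓡 3) (seamLift D bX Ψ) y :=
    (contMDiffAt_seamLift D bX Ψ hy).mdifferentiableAt (by simp)
  have hincl : MDifferentiableAt (𝓡 3) (𝓡∂ 4) bX.incl (seamLift D bX Ψ y) :=
    bX.isSmoothEmbedding.contMDiff.mdifferentiableAt (by simp)
  have hc : mfderiv (𝓡 3) (𝓡∂ 4) (bX.incl ∘ seamLift D bX Ψ) y =
      (mfderiv (𝓡 3) (𝓡∂ 4) bX.incl (seamLift D bX Ψ y)).comp
        (mfderiv (𝓡 3) (𝓡 3) (seamLift D bX Ψ) y) := mfderiv_comp y hincl hsl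
  have he : bX.incl ∘ seamLift D bX Ψ =ᶠ[𝓝 y] jAY D bX Ψ := by
    filter_upwards [isOpen_seamDom.mem_nhds hy] with y' hy'
    exact bX.incl_inclInv (jAY_mem_boundary D bX Ψ hy')
  have := congrArg (fun L : EuclideanSpace ℝ (Fin 3) →L[ℝ] EuclideanSpace ℝ (Fin 4) => L e)
    (hc.symm.trans (he.mfderiv_eq.trans (hasMFDerivAt_jAY D bX Ψ hy).mfderiv))
  exact this

/-- **The differential of the lift is injective** (`jA` is an immersion). [folklore] -/
theorem injective_mfderiv_seamLift {y : (bBase g).carrier} (hy : (y.1 : Base g) ∈ coresComplement h) :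
    Injective (mfderiv (𝓡 3) (𝓡 3) (seamLift D bX Ψ) y) := by
  intro e e' hee
  have h1 := congrArg (mfderiv (𝓡 3) (𝓡∂ 4) bX.incl (seamLift D bX Ψ y)) hee
  rw [mfderiv_incl_seamLift D bX Ψ hy, mfderiv_incl_seamLift D bX Ψ hy] at h1
  exact consZeroL_injective (injective_mfderiv_jA D _ h1)

/-! ## §3 The lifts of node T3c-2 are forced -/

/-- **The lift of a point is forced**: `bX.incl z = D.jA y` implies `z = seamLift y`. [folklore] -/
theorem eq_seamLift {y : (bBase g).carrier} (hy : (y.1 : Base g) ∈ coresComplement h)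
    {z : bX.carrier} (hz : bX.incl z = D.jA ⟨y.1, hy⟩) : z = seamLift D bX Ψ y :=
  bX.injective_incl (by rw [incl_seamLift D bX Ψ hy, hz])

/-- **The lift of a tangent vector is forced**: if `bX.incl z = D.jA y` and
`d(bX.incl)_z u = d(jA)_y ν` with `ν₀ = 0`, then `u = d(seamLift)_y (tail ν)`. [cite: LeeSmoothManifolds2013, Cor. 5.30] -/
theorem eq_mfderiv_seamLift {y : (bBase g).carrier} (hy : (y.1 : Base g) ∈ coresComplement h)
    {z : bX.carrier} (hz : bX.incl z = D.jA ⟨y.1, hy⟩) {ν : EuclideanSpace ℝ (Fin 4)}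
    (hν : ν 0 = 0) {u : EuclideanSpace ℝ (Fin 3)}
    (hu : mfderiv (𝓡 3) (𝓡∂ 4) bX.incl z u =
      mfderiv (𝓡∂ 4) (𝓡∂ 4) (fun a : ↥(coresComplement h) => D.jA a) ⟨y.1, hy⟩ ν) :
    u = mfderiv (𝓡 3) (𝓡 3) (seamLift D bX Ψ) y (tail 3 ν) := by
  have hzl : z = seamLift D bX Ψ y := eq_seamLift D bX Ψ hy hz
  subst hzl
  apply injective_mfderiv_boundaryIncl bX (seamLift D bX Ψ y)
  rw [hu, mfderiv_incl_seamLift D bX Ψ hy, consZeroL_apply, consCLE_tail_of_eq_zero 3 hν]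

/-- **The pushed point is `seamB y`.** [folklore] -/
theorem incl_apply_eq_seamB {y : (bBase g).carrier} (hy : (y.1 : Base g) ∈ coresComplement h)
    {z : bX.carrier} (hz : bX.incl z = D.jA ⟨y.1, hy⟩) :
    ((bBase g).incl (Ψ z) : Base g) = seamB D bX Ψ y := by
  rw [eq_seamLift D bX Ψ hy hz]; rfl

/-- **The pushed framing vector is `d(seamB)_y (tail ν)`.** [cite: LeeSmoothManifolds2013, Cor. 5.30] -/
theorem mfderiv_push_eq_mfderiv_seamB {y : (bBase g).carrier} (hy : (y.1 : Base g) ∈ coresComplement h)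
    {z : bX.carrier} (hz : bX.incl z = D.jA ⟨y.1, hy⟩) {ν : EuclideanSpace ℝ (Fin 4)}
    (hν : ν 0 = 0) {u : EuclideanSpace ℝ (Fin 3)}
    (hu : mfderiv (𝓡 3) (𝓡∂ 4) bX.incl z u =
      mfderiv (𝓡∂ 4) (𝓡∂ 4) (fun a : ↥(coresComplement h) => D.jA a) ⟨y.1, hy⟩ ν) :
    mfderiv (𝓡 3) (𝓡∂ 4) (fun y' => ((bBase g).incl (Ψ y') : Base g)) z u =
      mfderiv (𝓡 3) (𝓡∂ 4) (seamB D bX Ψ) y (tail 3 ν) := by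
  have hul := eq_mfderiv_seamLift D bX Ψ hy hz hν hu
  have hzl : z = seamLift D bX Ψ y := eq_seamLift D bX Ψ hy hz
  subst hzl
  rw [hul]
  have hG : MDifferentiableAt (𝓡 3) (𝓡∂ 4) (fun y' => ((bBase g).incl (Ψ y') : Base g))
      (seamLift D bX Ψ y) :=
    ((bBase g).isSmoothEmbedding.contMDiff.comp Ψ.contMDiff).mdifferentiableAt (by simp)
  have hsl : MDifferentiableAt (𝓡 3) (𝓡 3) (seamLift D bX Ψ) y :=
    (contMDiffAt_seamLift D bX Ψ hy).mdifferentiableAt (by simp)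
  have hc := mfderiv_comp y hG hsl
  have e : (fun y' => ((bBase g).incl (Ψ y') : Base g)) ∘ seamLift D bX Ψ = seamB D bX Ψ := rfl
  rw [e] at hc
  rw [hc]
  rfl

/-- **Sub-goal `helper_seamLift_forced` of stub `stub_T3_dualPresentation`** (T3 ▸ T3c-2 ▸ ST4
`node_ST4_twistSign`, brick X3-3a; wave 5, lead c5): **the lifts of node T3c-2 are forced.**  For the
data `(D, bX, Ψ)` of a fibred model and a boundary point `y` of the base off the cores: if
`bX.incl z = D.jA y` and `d(bX.incl)_z u = d(jA)_y ν` with `ν` tangent to the boundary (`ν₀ = 0`),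
then the pushed point `incl (Ψ z)` is the value `seamB D bX Ψ y` of the seam map (smooth on
`∂ Base g ∖ cores`) and the pushed vector `d(incl ∘ Ψ)_z u` is `d(seamB)_y (tail ν)`.
[cite: LeeSmoothManifolds2013, Cor. 5.30] -/
theorem helper_seamLift_forced : ∀ (g : ℕ) (ι : Type) [Finite ι] (h : ι → Literature.Topology.FourManifolds.HandleAttachingMap 3 2 (Literature.Topology.FourManifolds.LefschetzBase.Base g)) (X : Type) [TopologicalSpace X] [ChartedSpace (EuclideanHalfSpace 4) X] [IsManifold (𝓡∂ 4) ∞ X] (D : Literature.Topology.FourManifolds.HandleAttachingMap.MultiAttachmentData h (𝓡∂ 4) X) (bX : Literature.Topology.FourManifolds.BoundaryData (𝓡∂ 4) X (𝓡 3)) [Nonempty bX.carrier] (Ψ : bX.carrier ≃ₘ⟮𝓡 3, 𝓡 3⟯ (Literature.Topology.FourManifolds.LefschetzBase.bBase g).carrier) (y : (Literature.Topology.FourManifolds.LefschetzBase.bBase g).carrier) (hy : (y.1 : Literature.Topology.FourManifolds.LefschetzBase.Base g) ∈ Literature.Topology.FourManifolds.HandleAttachingMap.coresComplement h) (z : bX.carrier),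 bX.incl z = D.jA ⟨y.1, hy⟩ → ∀ (ν : EuclideanSpace ℝ (Fin 4)), ν 0 = 0 → ∀ (u : EuclideanSpace ℝ (Fin 3)), mfderiv (𝓡 3) (𝓡∂ 4) bX.incl z u = mfderiv (𝓡∂ 4) (𝓡∂ 4) (fun a : ↥(Literature.Topology.FourManifolds.HandleAttachingMap.coresComplement h) => D.jA a) ⟨y.1, hy⟩ ν → ((Literature.Topology.FourManifolds.LefschetzBase.bBase g).incl (Ψ z) : Literature.Topology.FourManifolds.LefschetzBase.Base g) = Summit.SmoothPoincare4.SmoothPoincare4.Theorems.AcyclicBisectionExists.ModpBraidOrbits.seamB D bX Ψ y ∧ mfderiv (𝓡 3) (𝓡∂ 4) (fun y' => ((Literature.Topology.FourManifolds.LefschetzBase.bBase g).incl (Ψ y') : Literature.Topology.FourManifolds.LefschetzBase.Base g)) z u = mfderiv (𝓡 3) (𝓡∂ 4) (Summit.SmoothPoincare4.SmoothPoincare4.Theorems.AcyclicBisectionExists.ModpBraidOrbits.seamB D bX Ψ) y (Literature.Topology.FourManifolds.BoundaryManifold.tail 3 ν) ∧ ContMDiffAt (𝓡 3) (𝓡∂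 4) ∞ (Summit.SmoothPoincare4.SmoothPoincare4.Theorems.AcyclicBisectionExists.ModpBraidOrbits.seamB D bX Ψ) y :=
  fun _ _ _ _ _ _ _ _ D bX _ Ψ _ hy _ hz _ hν _ hu =>
    ⟨incl_apply_eq_seamB D bX Ψ hy hz, mfderiv_push_eq_mfderiv_seamB D bX Ψ hy hz hν hu,
      contMDiffAt_seamB D bX Ψ hy⟩

end Seam

end Summit.SmoothPoincare4.SmoothPoincare4.Theorems.AcyclicBisectionExists.ModpBraidOrbits

end
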